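/-
Copyright (c) 2026 the pub-hodgecm-mathlib formalisation cell (harness21).  Prover seat hodgecm-mathlib-LH4-p16 (g2), req620 Track A «(D-RAM) FOUR-FRAME» squad
(STAGE-1b, row (2) of the piece `f_{T₊}`, the (β₂) road (R-36); β₂ sub-dealer LH4-p04 (g9) (L-Σ-3C), lane-C hinge LH7-p10 (g2); the token dictionary of the
lane-C per-vertex letters ★ p862581 `…NearCellFlippedLetter` ∕ ★ p861810), 2026-09-04.
-/
import Summits.HodgeConjecture.HodgeConjecture.Theorems.F0P3cDyRamRayScalarBoundaryTerm     -- ★ p862205∕p862234 (this lineage): `hk_of_lt`, `v_mul_pow_le_one_of_int`, `v_map_mul_pow_le_one`; brings ★ DEFS `IsOrd`, `dualGen`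
import HarnessLib

/-!
# Crux `H413`, line LH4 «(D-RAM) FOUR-FRAME» — STAGE-1b, row (2), the (β₂) road (R-36), lane C: «THE RAY-LETTER BINDERS OF LANE C FROM THE TOKENS» — the three
# regime binders of ★ p862581 (`hμ hμt hmm` order-integrality of the depth multiplier at the modulus; `hflip` ∕ `hclean` the boundary digit) are TOKEN ARITHMETIC:
# `|μ_a| ≤ |ϖ|^{m′}`, `|μ_b| ≤ |ϖ|^{m′ + j}` give `μ ∈ jE(ϖ^{m′})·𝒪_{jEϖ^j}`; `|jE μ_b|·|D₀|⁻¹·|α − ρα| = |jEϖ|^{jl − j − a}` on the cell `(j, a)` — FLIP iff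
# `jl = j + a + m* − 1`, CLEAN iff `j + a + m* ≤ jl`

Cell `hodgecm-mathlib` (D-0151), FLOOR 0, crux item H413 = `stmt-HodgeConjecture-24833`, route of record `HCCMUnconditional`; squad F0∕P3c∕LH4; lane
`--supports stmt-HodgeConjecture-24833 --as helper` (count-neutral; pays NO tier-0 row).  THEOREMS ONLY (no `def`, no instance, no notation, no `sorry`, default heartbeats);
★-only imports; states NO law; (β₂) stays a HYPOTHESIS.  DATUM-FREE `M`-letters (`jE : E → M`, `ρ` fixing `jE(E)`, `α`, the cell scalar `D₀ = cc·(α − ρα)·ΘY`).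

WHY (★ p862581 HEAD `valueSet_endoGL_sub_one_glued_eq_twist_smul_xPlus_of_flip` ∕ HEAD′ `…_of_clean` and ★ p861653∕p861810 take as BINDERS: (a) `hμ : lam − jE u₀₀ = jE(ϖ^{m′})·μ̃`,
`hμt : IsOrd ρ α cc μ̃`, `hmm : m* ≤ m′` — the depth multiplier is order-integral at the modulus; (b) `hflip : |jE μ_b|·|D₀|⁻¹·|α − ρα| = |jEϖ|^{2(d−1)+d%2}` resp. `hclean :
|jE μ_b|·max(|Tr_ρ D₀⁻¹|, |D₀|⁻¹·|α − ρα|) ≤ |jEϖ|^{m*}`; LH7-p09 (g2) 22:37:23Z census letters `m₀ = v(μ)`, `jl′`, cell `(j, b)`; ★ p862235 `v_cellScalar_ramM`.)  With the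
`jE(E)`-coordinates `lam − jE u₀₀ = jE μ_a + jE μ_b·α` (★ p862572 §1 `map_sub_div_eq` ∕ `map_sub_mul_eq`: `B = (z − ρz)∕(α − ρα)`) these binders are pure token arithmetic:
* §1 `exists_isOrd_of_coords` — `|jE μ_a| ≤ |jEϖ|^{m′}`, `|jE μ_b| ≤ |jEϖ|^{m′}` and `|jE μ_b| ≤ |jEϖ|^{m′ + j}·` (conductor `cc = jEϖ^j`), `|α| ≤ 1` ⟹ `∃ μ̃`, `μ = jE(ϖ^{m′})·μ̃ ∧
  IsOrd ρ α (jEϖ^j) μ̃` — (a) with `m′ := m*` needs only `m* ≤ v(μ_a)` and `m* + j ≤ jl`.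
* §2 `v_boundaryDigit_eq` — for `D₀ = cc·(α − ρα)·ΘY` with `|cc| = |jEϖ|^j`, `|Y| = |jEϖ|^a`, `Θ` isometric, `α ≠ ρα`, `|jE μ_b| = |jEϖ|^{jl}`, `j + a ≤ jl`:
  `|jE μ_b|·|D₀|⁻¹·|α − ρα| = |jEϖ|^{jl − j − a}` (`|α − ρα|` CANCELS — no `ρ`-datum digit enters); hence `hflip` ⟺ `jl − j − a = 2(d−1) + d%2` (`v_boundaryDigit_eq_flip`) and,
  under `hk`, `hclean` ⟸ `j + a + m* ≤ jl` (`v_boundary_max_le_of_hk`); without `hk` (the diagonal) the glue bound `|jE pw|·|jEϖ|^{2b} ≤ 1` gives `hclean` from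
  `j + a + m* ≤ jl ∧ 2b + m* ≤ jl` (`v_boundary_max_le_of_pairing`) — the CRUDE diagonal reading (MECH-K0 v2: one digit short of the truth on `D`).
* §3 ROW READING (doc only, no new decl): on the row `a = b` of the census (`|μ_a| = |ϖ|^{2b + d%2}`), writing `k′ := j − b` and `δ′ := jl − 2b`, the cell `(b + k′, b)` is CLEAN
  for `k′ ≤ δ′ − m*`, FLIPS at `k′ = δ′ + 1 − m*` (`= δ′ − 2(d−1) − d%2`), `hk` holding for every `k′ ≥ 1` (★ `hk_of_lt`); `K₀` is `k′ = s0` (LH7-p10 (g2) spelling `K₀ = (a + s0, a)`),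
  so «`K₀` flips at `jl = 2b + s0 + m* − 1`» (★ p862630's «on the nose» digit) and the tower cells flip one after the other as `δ′` grows — MECH-K0 v2 (d = 3, m* = 6,
  b = 3, s0 = 1): key (13,7) has `jl = 12`, `δ′ = 6`, flip at `k′ = 1 = s0` (K₀ ✓); key (15,7) has `jl = 14`, `δ′ = 8`, flip at `k′ = 3`, i.e. the cell `(6, 3)` = F0P3-p01 (g37)
  22:18:32Z's «(6,6) unbalanced at (15,7)» ✓, with `K₀` (`k′ = 1 ≤ δ′ − m* = 2`) CLEAN there (cdis1 «K₀ = +D at δ ≥ 8») ✓.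
WHAT IS NOT CLAIMED: the coordinates themselves (★ p862572 §1), the tokens (`hm hjl` of the frame), `hk` (★ `hk_of_lt`), the `E`-letter (★ p862630), anything about labels.
HONEST LABEL.  Count-neutral valuation bookkeeping; nothing printed is asserted; no census law is stated; `HC_CM` is proved only modulo the 7 printed citations (2 remaining named
inputs: hLiu418 = `stmt-HodgeConjecture-24832`, h413 = `stmt-HodgeConjecture-24833`) until rung 0 closes.
## References
* [Serre1979] J.-P. Serre, *Local Fields*, GTM 67 (1979): Ch. III §6 Prop. 12 (orders of conductor `c`), Ch. V §3 Cor. 3.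
* [Jacobowitz1962] R. Jacobowitz, *Hermitian forms over local fields*, Amer. J. Math. 84 (1962): §4 (dual lattices, gluing); [Kottwitz1986BaseChangeUnits] R. E. Kottwitz, *Base change
  for unit elements of Hecke algebras*, Compositio Math. 60 (1986): §1 pp. 240–241; [Rogawski1990] J. D. Rogawski, Ann. of Math. Stud. 123 (1990): §4.9 Prop. 4.9.1 (b) p. 55.
-/

set_option autoImplicit false

noncomputable section

namespace Summit.HodgeConjecture.HodgeConjecture.Cruxes.H413.F0P3cDyRamRayLettersTokensRamM

open scoped Valued WithZero
open WithZero
open Summit.HodgeConjecture.HodgeConjecture.Cruxes.H413.F0P3cDyRamFourFramePieces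
open Summit.HodgeConjecture.HodgeConjecture.Cruxes.H413.F0P3cDyRamToricCensusDefs
open Summit.HodgeConjecture.HodgeConjecture.Cruxes.H413.F0P3cDyRamRayScalarBoundaryTerm (v_map_mul_pow_le_one)

variable {E M : Type} [Field E] [Field M] [Valued M ℤᵐ⁰] {ρ Θ : M →+* M} {α : M}

/-! ## §1 Order-integrality of the depth multiplier at the modulus, from the sizes of its two coordinates -/

/-- **`μ ∈ jE(ϖ^{m′})·𝒪_{jEϖ^j}` FROM THE COORDINATE SIZES.**  For `μ = jE μ_a + jE μ_b·α` with `ρ` fixing `jE(E)`, `|α| ≤ 1`, `ϖ ≠ 0` and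
`|jE μ_a| ≤ |jEϖ|^{m′}`, `|jE μ_b| ≤ |jEϖ|^{m′}`, `|jE μ_b| ≤ |jEϖ|^{m′ + j}`: `μ = jE(ϖ^{m′})·μ̃` with `IsOrd ρ α (jEϖ^j) μ̃` — the letters `hμ hμt` of ★ p861653 ∕ ★ p862581
(`hmm : m* ≤ m′` is the consumer's choice `m′ := m*`). [cite: Serre1979, Ch. III §6 Prop. 12] -/
theorem exists_isOrd_of_coords (jE : E →+* M) (hρj : ∀ c, ρ (jE c) = jE c) (hα1 : Valued.v α ≤ 1) {ϖ : E} (hϖ0 : ϖ ≠ 0)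
    {μ : M} {μa μb : E} (hμab : μ = jE μa + jE μb * α) {m' j : ℕ}
    (hμa : Valued.v (jE μa) ≤ Valued.v (jE ϖ) ^ m') (hμb : Valued.v (jE μb) ≤ Valued.v (jE ϖ) ^ m')
    (hμbj : Valued.v (jE μb) ≤ Valued.v (jE ϖ) ^ (m' + j)) :
    ∃ μt : M, μ = jE (ϖ ^ m') * μt ∧ IsOrd ρ α (jE ϖ ^ j) μt := by
  have hπ0 : jE ϖ ≠ 0 := (map_ne_zero jE).2 hϖ0
  have hπm0 : jE ϖ ^ m' ≠ 0 := pow_ne_zero _ hπ0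
  have hvπm : (0 : ℤᵐ⁰) < Valued.v (jE ϖ) ^ m' := zero_lt_iff.2 (by rw [← Valuation.map_pow]; exact (Valuation.ne_zero_iff _).2 hπm0)
  refine ⟨(jE ϖ ^ m')⁻¹ * μ, by rw [map_pow, mul_inv_cancel_left₀ hπm0], ?_, ?_⟩
  · -- `|μ̃| ≤ 1`
    rw [Valuation.map_mul, map_inv₀, Valuation.map_pow, inv_mul_le_iff₀ hvπm, mul_one, hμab]
    refine (Valuation.map_add _ _ _).trans (max_le hμa ?_)
    rw [Valuation.map_mul]
    calc Valued.v (jE μb) * Valued.v α ≤ Valued.v (jE ϖ) ^ m' * 1 := mul_le_mul' hμb hα1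
      _ = _ := mul_one _
  · -- `|μ̃ − ρμ̃| ≤ |jEϖ^j·(α − ρα)|`
    have hρπ : ρ (jE ϖ ^ m')⁻¹ = (jE ϖ ^ m')⁻¹ := by rw [map_inv₀, map_pow, hρj]
    have e : (jE ϖ ^ m')⁻¹ * μ - ρ ((jE ϖ ^ m')⁻¹ * μ) = (jE ϖ ^ m')⁻¹ * (jE μb * (α - ρ α)) := by
      rw [map_mul, hρπ, hμab, map_add, map_mul, hρj, hρj]; ring
    rw [e, Valuation.map_mul, map_inv₀, Valuation.map_pow, inv_mul_le_iff₀ hvπm, Valuation.map_mul, Valuation.map_mul, Valuation.map_pow,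
      ← mul_assoc, ← pow_add]
    exact mul_le_mul' hμbj le_rfl

/-! ## §2 The boundary digit `|jE μ_b|·|D₀|⁻¹·|α − ρα|` on the cell `(j, a)`: `|α − ρα|` cancels -/

/-- **THE BOUNDARY DIGIT IS `|jEϖ|^{jl − j − a}`.**  For `D₀ = cc·(α − ρα)·ΘY` with `|cc| = |jEϖ|^j` (the conductor), `|Y| = |jEϖ|^a` (the level), `Θ` isometric, `α ≠ ρα`,
`jEϖ ≠ 0`, and `|jE μ_b| = |jEϖ|^{jl}` with `j + a ≤ jl`: `|jE μ_b|·|D₀|⁻¹·|α − ρα| = |jEϖ|^{jl − j − a}` — the `ρ`-datum digit `|α − ρα|` CANCELS, so the reading is the same in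
every lane. [cite: Jacobowitz1962, §4] [cite: Serre1979, Ch. III §6 Prop. 12] -/
theorem v_boundaryDigit_eq (hvΘ : ∀ x, Valued.v (Θ x) = Valued.v x) (hα0 : α - ρ α ≠ 0) (jE : E →+* M) {ϖ : E} (hπ0 : Valued.v (jE ϖ) ≠ 0)
    {cc Y D₀ : M} (hD₀ : D₀ = cc * (α - ρ α) * Θ Y) {j a jl : ℕ} (hccv : Valued.v cc = Valued.v (jE ϖ) ^ j) (hY : Valued.v Y = Valued.v (jE ϖ) ^ a)
    {μb : E} (hμb : Valued.v (jE μb) = Valued.v (jE ϖ) ^ jl) (hle : j + a ≤ jl) :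
    Valued.v (jE μb) * (Valued.v D₀)⁻¹ * Valued.v (α - ρ α) = Valued.v (jE ϖ) ^ (jl - j - a) := by
  have hαv : Valued.v (α - ρ α) ≠ 0 := (Valuation.ne_zero_iff _).2 hα0
  obtain ⟨k, rfl⟩ : ∃ k, jl = j + a + k := ⟨jl - (j + a), by omega⟩
  have hD₀v : Valued.v D₀ = Valued.v (jE ϖ) ^ (j + a) * Valued.v (α - ρ α) := by
    rw [hD₀, Valuation.map_mul, Valuation.map_mul, hvΘ, hccv, hY, pow_add, mul_right_comm]
  have hja0 : Valued.v (jE ϖ) ^ (j + a) ≠ 0 := pow_ne_zero _ hπ0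
  rw [hD₀v, hμb, show j + a + k - j - a = k by omega, pow_add]
  field_simp

/-- **`hflip` FROM THE TOKENS**: under `v_boundaryDigit_eq`'s letters, `jl − j − a = 2(d−1) + d%2` gives ★ p862581 HEAD's `hflip`. [cite: Serre1979, Ch. V §3 Cor. 3] -/
theorem v_boundaryDigit_eq_flip (hvΘ : ∀ x, Valued.v (Θ x) = Valued.v x) (hα0 : α - ρ α ≠ 0) (jE : E →+* M) {ϖ : E} (hπ0 : Valued.v (jE ϖ) ≠ 0)
    {cc Y D₀ : M} (hD₀ : D₀ = cc * (α - ρ α) * Θ Y) {j a jl d : ℕ} (hccv : Valued.v cc = Valued.v (jE ϖ) ^ j) (hY : Valued.v Y = Valued.v (jE ϖ) ^ a)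
    {μb : E} (hμb : Valued.v (jE μb) = Valued.v (jE ϖ) ^ jl) (hflip : jl = j + a + (2 * (d - 1) + d % 2)) :
    Valued.v (jE μb) * (Valued.v D₀)⁻¹ * Valued.v (α - ρ α) = Valued.v (jE ϖ) ^ (2 * (d - 1) + d % 2) := by
  rw [v_boundaryDigit_eq hvΘ hα0 jE hπ0 hD₀ hccv hY hμb (by omega)]
  congr 1; omega

/-- **`hclean` FROM THE TOKENS, ABOVE THE DIAGONAL** (`hk` holds): `j + a + m ≤ jl` gives `|jE μ_b|·max(|Tr_ρ D₀⁻¹|, |D₀|⁻¹·|α − ρα|) ≤ |jEϖ|^m` (★ p862581 HEAD′'s `hclean`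
at `m := m*`). [cite: Serre1979, Ch. III §6 Prop. 12] [cite: Serre1979, Ch. V §3 Cor. 3] -/
theorem v_boundary_max_le_of_hk (hvΘ : ∀ x, Valued.v (Θ x) = Valued.v x) (hα0 : α - ρ α ≠ 0) (jE : E →+* M) {ϖ : E} (hπ0 : Valued.v (jE ϖ) ≠ 0)
    (hπ1 : Valued.v (jE ϖ) ≤ 1) {cc Y D₀ : M} (hD₀ : D₀ = cc * (α - ρ α) * Θ Y) {j a jl m : ℕ} (hccv : Valued.v cc = Valued.v (jE ϖ) ^ j)
    (hY : Valued.v Y = Valued.v (jE ϖ) ^ a) {μb : E} (hμb : Valued.v (jE μb) = Valued.v (jE ϖ) ^ jl) (hle : j + a + m ≤ jl)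
    (hk : Valued.v (D₀⁻¹ + ρ D₀⁻¹) < Valued.v D₀⁻¹ * Valued.v (α - ρ α)) :
    Valued.v (jE μb) * max (Valued.v (D₀⁻¹ + ρ D₀⁻¹)) ((Valued.v D₀)⁻¹ * Valued.v (α - ρ α)) ≤ Valued.v (jE ϖ) ^ m := by
  have hmax : max (Valued.v (D₀⁻¹ + ρ D₀⁻¹)) ((Valued.v D₀)⁻¹ * Valued.v (α - ρ α)) = (Valued.v D₀)⁻¹ * Valued.v (α - ρ α) := by
    rw [← map_inv₀]; exact max_eq_right hk.le
  rw [hmax, ← mul_assoc, v_boundaryDigit_eq hvΘ hα0 jE hπ0 hD₀ hccv hY hμb (by omega)]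
  exact pow_le_pow_right_of_le_one' hπ1 (by omega)

/-- **`hclean` FROM THE TOKENS, WITHOUT `hk`** (the diagonal cell, CRUDE reading): the glue letter `D₀⁻¹ + ρD₀⁻¹ = jE pw` with `|jE pw|·|jEϖ|^{2b} ≤ 1` (★ p862234
`v_map_mul_pow_le_one`) bounds the trace term by `|jEϖ|^{jl − 2b}`; so `j + a + m ≤ jl` and `2b + m ≤ jl` give `hclean`.  (MECH-K0 v2: on `D` the truth is one digit better —
the `D`-side factorisation, not this lemma.) [cite: Jacobowitz1962, §4] [cite: Serre1979, Ch. III §6 Prop. 12] -/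
theorem v_boundary_max_le_of_pairing (hvΘ : ∀ x, Valued.v (Θ x) = Valued.v x) (hα0 : α - ρ α ≠ 0) (jE : E →+* M) {ϖ : E} (hπ0 : Valued.v (jE ϖ) ≠ 0)
    (hπ1 : Valued.v (jE ϖ) ≤ 1) {cc Y D₀ : M} (hD₀ : D₀ = cc * (α - ρ α) * Θ Y) {j a jl m b : ℕ} (hccv : Valued.v cc = Valued.v (jE ϖ) ^ j)
    (hY : Valued.v Y = Valued.v (jE ϖ) ^ a) {μb : E} (hμb : Valued.v (jE μb) = Valued.v (jE ϖ) ^ jl) (hle : j + a + m ≤ jl) (hb : 2 * b + m ≤ jl)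
    {pw : E} (hTr : D₀⁻¹ + ρ D₀⁻¹ = jE pw) (hpw : Valued.v (jE pw) * Valued.v (jE ϖ) ^ (2 * b) ≤ 1) :
    Valued.v (jE μb) * max (Valued.v (D₀⁻¹ + ρ D₀⁻¹)) ((Valued.v D₀)⁻¹ * Valued.v (α - ρ α)) ≤ Valued.v (jE ϖ) ^ m := by
  have h2 : Valued.v (jE μb) * ((Valued.v D₀)⁻¹ * Valued.v (α - ρ α)) ≤ Valued.v (jE ϖ) ^ m := by
    rw [← mul_assoc, v_boundaryDigit_eq hvΘ hα0 jE hπ0 hD₀ hccv hY hμb (by omega)]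
    exact pow_le_pow_right_of_le_one' hπ1 (by omega)
  have h1 : Valued.v (jE μb) * Valued.v (D₀⁻¹ + ρ D₀⁻¹) ≤ Valued.v (jE ϖ) ^ m := by
    -- the trace term: `|jE μb|·|jE pw| = |jEϖ|^{m+k}·(|jE pw|·|jEϖ|^{2b}) ≤ |jEϖ|^m`
    obtain ⟨k, rfl⟩ : ∃ k, jl = 2 * b + m + k := ⟨jl - (2 * b + m), by omega⟩
    rw [hTr, hμb, show 2 * b + m + k = (m + k) + 2 * b by ring, pow_add, mul_assoc, mul_comm (Valued.v (jE ϖ) ^ (2 * b))]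
    calc Valued.v (jE ϖ) ^ (m + k) * (Valued.v (jE pw) * Valued.v (jE ϖ) ^ (2 * b)) ≤ Valued.v (jE ϖ) ^ m * 1 :=
          mul_le_mul' (pow_le_pow_right_of_le_one' hπ1 (Nat.le_add_right m k)) hpw
      _ = Valued.v (jE ϖ) ^ m := mul_one _
  rcases le_total (Valued.v (D₀⁻¹ + ρ D₀⁻¹)) ((Valued.v D₀)⁻¹ * Valued.v (α - ρ α)) with h | h
  · rw [max_eq_right h]; exact h2
  · rw [max_eq_left h]; exact h1

end Summit.HodgeConjecture.HodgeConjecture.Cruxes.H413.F0P3cDyRamRayLettersTokensRamM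

end
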